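import Summits.QuantumFields.BalabanUV.Beta.EriceRemainderEnclosureHistoryAutonomyComparisonAgeCompositionRowMass

/-!
# EriceRemainderEnclosureHistoryAutonomyComparisonAgeCompositionTailSums — (E81f) THE READ-DECAY INEQUALITY IS STATIC TOO: for an input that is
# non-negative, NON-DECREASING below its edge and grows per pin by at most a factor `H_m`, the reads by a window kernel satisfy `c·R v (n+1) ≤ R v n` as
# soon as the TAIL SUMS of the row dominate those of the next row weighted by `c·H`: `c·Σ_{l≥L'} H_{n+1+l}K (n+1) l ≤ Σ_{l≥L'} K n l` (Abel summation with
# non-decreasing weights) — with `c = 1 + M_n` this is (E81a)'s read-decay hypothesis for MONO″, with `c = 1` it propagates «surplus non-decreasing in depth»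

Cell `pub-balaban`, β-function sub-cell, BINDER row D4 «RemainderConst leaves for Bałaban's split» (`HOME/BINDER-OWNERS.md`; owner lineage `b2b-balaban-beta-an4`;
this file by co-owner #2 lineage `b2b-balaban-beta-d4-p2`, generation 72), β-FLOW TEAM duty (1), FREEZE (0) honoured (def-free; imports (E81e) `…RowMass`
(for the tree position only); Mathlib `Finset` algebra; nothing restated).

HONEST FRAMING (page 1, verbatim and binding).  *"Discharging BetaPertH makes Bałaban's UV stability UNCONDITIONAL — a real constructive-QFT result; it is
NOT the continuum limit and NOT the Clay problem."*  THIS FILE DISCHARGES NOTHING OF THE KIND.  Elementary real algebra about ABSTRACT kernels and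
sequences — hypotheses of a census, not facts; the age profile of Bałaban's (1.22) limit functional is NOT PRINTED ([I] p. 298; GAPS G-t4-U2-1∕-2) and NOT
asserted.  Row D4 class UNCHANGED (critical-path width 0; instance 0∕1; D4 DISCHARGE NO DATE).  HONEST DEPENDENCY: continuum YM on T⁴ ⇐ BetaPertH ∧ nine
spine estimates (0/9 proved); BetaPertH ⇐ (D1) ∧ (D4) ∧ CAP+tail; G-an2-4 gates asym, D1 and NE2/3/4.

THE POINT (census sense (α); route (N); README `g72/e81/README.md` §5).  (E81d) `flow_nonneg_of_criteria` left two families: (a) row masses (→ (E81e)) and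
(b) the READ-DECAY inequality `M_n·A (n+1) ≤ A n − A (n+1)` for the young reads `A = RL i v` of old surpluses `v = SA (i+1) w`.  (b) is LINEAR in `w`, so it
suffices for the truncations `w = 1_{[0,j]}`, whose old surpluses are non-negative, vanish beyond the edge `j`, are NON-DECREASING in depth below the edge
(the (M1) property of the old system — `g72/numerics/m18.py`: 0 violations at every level of every profile) and grow per pin by at most the Harnack-step
factor `H_m = (1 + Σ_{k>i}θ̂_k(m;1)β_k(m))∕(1 − Σ_{k>i}κ^k_{m,0})` of (E71c) `harnack_step` (`l = 1`) with the static chain's carried ratios (`m16.py`: the bound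
is attained).  For such an input THIS FILE proves (§2 **`scaled_read_le_of_tail_sums`**): `c·R v (n+1) ≤ R v n` follows from the STATIC TAIL-SUM INEQUALITIES
`c·Σ_{l∈[L',L⁺]} H_{n+1+l}·K (n+1) l ≤ Σ_{l∈[L',L]} K n l` for the lags below the edge (`L = min(y−1, j−n−1)`, `L⁺ = min(y−1, j−n−2)`), by ABEL SUMMATION
WITH NON-DECREASING WEIGHTS (§1 **`abel_nonneg_mono`**: `Σ x_lb_l ≥ 0` when every TAIL sum of `x` is `≥ 0` and `b ≥ 0` is non-decreasing) — the
termwise-in-lag comparison is FALSE at the pin when a saturated YOUNGER age damps the head of the window (`m16.py`: ratio 1.025), the tail-sum form holds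
on every profile tested (`m17.py`: worst 0.987 full windows, 0.88 partial).  With `c = 1 + M_n` this is (b); with `c = 1` it is «reads of the surplus are
non-increasing», i.e. the DROPS of a surplus that is non-decreasing below its edge are non-increasing — which is how (M1) itself propagates down the ages.  SO,
after this file, EVERY remaining hypothesis of route (N)'s first-order END is a STATIC inequality between kernel entries, the chain's ratios and the
per-pin Harnack factors: no solution of any triangular system is left in the hypotheses (README §5: (S-a) row mass ∕ hybrid, (S-b) tail sums with
`c = 1 + M`, (S-c) tail sums with `c = 1` for the aggregate kernel).  NOT CLAIMED: any of (S-a,b,c) for the flow; anything nonlinear; anything printed.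

WHAT IS PROVED ([folklore]; 0 `def`, 0 sorry).  §1 `mono_chain_zero`, **`abel_nonneg_mono`**.  §2 `read_eq_sum_window`, **`scaled_read_le_of_tail_sums`**,
`read_decay_of_tail_sums` (`c = 1 + M`), `read_antitone_of_tail_sums` (`c = 1`).
-/
noncomputable section
open Finset

namespace Summit.QuantumFields.BalabanUV.Beta.EriceRemainderEnclosureHistoryAutonomyComparisonAgeCompositionTailSums

/-! ## §1 Abel summation against a non-decreasing non-negative weight: tail sums -/

/-- A sequence non-decreasing below `N` dominates its head there. [folklore] -/
theorem mono_chain_zero {N : ℕ} {b : ℕ → ℝ} (hb : ∀ l, l + 1 < N → b l ≤ b (l + 1)) : ∀ j, j < N → b 0 ≤ b j := by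
  intro j
  induction j with
  | zero => intro _; exact le_rfl
  | succ j ih => intro hj; exact (ih (by omega)).trans (hb j hj)

/-- **ABEL, NON-DECREASING WEIGHTS.**  If every TAIL sum `Σ_{l∈[L,N)} x l` is `≥ 0` and `b` is non-negative and non-decreasing below `N`, then
`Σ_{l<N} x l · b l ≥ 0`. [folklore] -/
theorem abel_nonneg_mono : ∀ (N : ℕ) (x b : ℕ → ℝ), (∀ L, L < N → 0 ≤ ∑ l ∈ Ico L N, x l) →
    (∀ l, l < N → 0 ≤ b l) → (∀ l, l + 1 < N → b l ≤ b (l + 1)) → 0 ≤ ∑ l ∈ range N, x l * b l := by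
  intro N
  induction N with
  | zero => intro x b _ _ _; simp
  | succ N ih =>
    intro x b hX hb0 hba
    have hsplit : ∑ l ∈ range (N + 1), x l * b l = b 0 * ∑ l ∈ Ico 0 (N + 1), x l + ∑ l ∈ range N, x (l + 1) * (b (l + 1) - b 0) := by
      have e1 := sum_range_succ' (fun l => x l * b l) N
      have e2 : ∑ l ∈ Ico 0 (N + 1), x l = ∑ l ∈ range N, x (l + 1) + x 0 := by rw [← range_eq_Ico]; exact sum_range_succ' x N
      have e3 : ∑ l ∈ range N, x (l + 1) * (b (l + 1) - b 0) = ∑ l ∈ range N, x (l + 1) * b (l + 1) - b 0 * ∑ l ∈ range N, x (l + 1) := by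
        rw [mul_sum, ← sum_sub_distrib]; exact sum_congr rfl fun l _ => by ring
      rw [e1, e2, e3]; ring
    rw [hsplit]
    refine add_nonneg (mul_nonneg (hb0 0 (by omega)) (hX 0 (by omega))) ?_
    refine ih (fun l => x (l + 1)) (fun l => b (l + 1) - b 0) (fun L hL => ?_) (fun l hl => ?_) (fun l hl => ?_)
    · rw [sum_Ico_add' x L N 1]; exact hX (L + 1) (by omega)
    · linarith [mono_chain_zero hba (l + 1) (by omega)]
    · linarith [hba (l + 1) (by omega)]

/-! ## §2 Scaled read comparisons from static tail sums -/

section Reads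

variable {N y : ℕ} {K : ℕ → ℕ → ℝ} {R : (ℕ → ℝ) → ℕ → ℝ}

/-- A read of an input vanishing beyond the edge `j` by a window kernel (lags `< y ≤ N`) is the sum over the lags `≤ L` for any `L < y` with
`n + 1 + L ≤ j` beyond which either the kernel or the input vanishes. [folklore] -/
theorem read_eq_sum_window (hR : ∀ v n, R v n = ∑ l ∈ range N, K n l * v (n + 1 + l)) (hKy : ∀ n l, y ≤ l → K n l = 0) (hyN : y ≤ N)
    {v : ℕ → ℝ} {j : ℕ} (hvj : ∀ m, j < m → v m = 0) (n L : ℕ) (hL : L < y) (hcut : ∀ l, L < l → l < y → j < n + 1 + l) :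
    R v n = ∑ l ∈ range (L + 1), K n l * v (n + 1 + l) := by
  rw [hR, ← sum_range_add_sum_Ico _ (by omega : L + 1 ≤ N)]
  rw [sum_eq_zero (s := Ico (L + 1) N) fun l hl => ?_, add_zero]
  have hl := (mem_Ico.mp hl).1
  rcases Nat.lt_or_ge l y with hly | hly
  · rw [hvj _ (hcut l (by omega) hly), mul_zero]
  · rw [hKy n l hly, zero_mul]

/-- **SCALED READ COMPARISON FROM STATIC TAIL SUMS.**  Window kernel `K ≥ 0` (lags `< y`, `1 ≤ y ≤ N`); an input `v ≥ 0` vanishing beyond the edge `j`,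
NON-DECREASING below it (`v m ≤ v (m+1)` for `m < j`) and growing per pin by at most `H m` there (`v (m+1) ≤ H m·v m`); a factor `c ≥ 0`.  If for the pin
`n` the tail sums satisfy — with `L = min(y−1, j−n−1)` the last lag of row `n` below the edge and `L⁺ = min(y−1, j−n−2)` that of row `n+1` —
`c·Σ_{l∈[L',L⁺]} H (n+1+l)·K (n+1) l ≤ Σ_{l∈[L',L]} K n l` for every `L' ≤ L` (stated as the two hypotheses `hfull` ∕ `hpart`), then
**`c·R v (n+1) ≤ R v n`**.  (Rows entirely beyond the edge read `0`.) [folklore] -/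
theorem scaled_read_le_of_tail_sums (hR : ∀ v n, R v n = ∑ l ∈ range N, K n l * v (n + 1 + l)) (hK : ∀ n l, 0 ≤ K n l)
    (hKy : ∀ n l, y ≤ l → K n l = 0) (hy : 1 ≤ y) (hyN : y ≤ N)
    {v : ℕ → ℝ} {j : ℕ} (hv0 : ∀ m, 0 ≤ v m) (hvj : ∀ m, j < m → v m = 0) (hmono : ∀ m, m < j → v m ≤ v (m + 1))
    {H : ℕ → ℝ} (hgrow : ∀ m, m < j → v (m + 1) ≤ H m * v m) {c : ℝ} (hc : 0 ≤ c) {n : ℕ}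
    (hfull : n + 1 + y ≤ j → ∀ L', L' < y → c * ∑ l ∈ Ico L' y, H (n + 1 + l) * K (n + 1) l ≤ ∑ l ∈ Ico L' y, K n l)
    (hpart : ∀ L, n + 1 + L = j → L < y → ∀ L', L' ≤ L → c * ∑ l ∈ Ico L' L, H (n + 1 + l) * K (n + 1) l ≤ ∑ l ∈ Ico L' (L + 1), K n l) :
    c * R v (n + 1) ≤ R v n := by
  -- (A) the row n+1 entirely beyond the edge... in fact: if j < n + 1 + 0 then both reads vanish
  rcases Nat.lt_or_ge j (n + 1) with hj | hj
  · have h1 : R v (n + 1) = 0 := by rw [hR]; exact sum_eq_zero fun l _ => by rw [hvj _ (by omega), mul_zero]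
    have h0 : R v n = 0 := by rw [hR]; exact sum_eq_zero fun l _ => by rw [hvj _ (by omega), mul_zero]
    rw [h1, h0, mul_zero]
  -- common shape: R v n = Σ_{l ≤ L} K n l v(n+1+l), and c R v (n+1) ≤ c Σ_{l < L⁺+1} H K(n+1) l v(n+1+l) with the static tails
  -- define L (last lag of row n below the edge) and Lp = number of lags of row n+1 below the edge (= L⁺ + 1)
  obtain ⟨L, Lp, hLy, hLp, hLj, hrowN, hrowN1, hreach, hstat⟩ : ∃ L Lp : ℕ, L < y ∧ Lp ≤ L + 1 ∧ n + 1 + L ≤ j ∧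
      R v n = ∑ l ∈ range (L + 1), K n l * v (n + 1 + l) ∧
      R v (n + 1) = ∑ l ∈ range Lp, K (n + 1) l * v (n + 2 + l) ∧ (∀ l, l < Lp → n + 2 + l ≤ j) ∧
      ∀ L', L' ≤ L → c * ∑ l ∈ Ico L' Lp, H (n + 1 + l) * K (n + 1) l ≤ ∑ l ∈ Ico L' (L + 1), K n l := by
    rcases Nat.lt_or_ge j (n + 1 + y) with hjy | hjy
    · -- partial: L = j − n − 1 < y, row n+1 has the lags < L
      have hrow1 : R v (n + 1) = ∑ l ∈ range (j - (n + 1)), K (n + 1) l * v (n + 2 + l) := by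
        rcases Nat.eq_zero_or_pos (j - (n + 1)) with h0 | h0
        · rw [h0, sum_range_zero, hR]
          exact sum_eq_zero fun l _ => by rw [hvj _ (by omega), mul_zero]
        · rw [read_eq_sum_window hR hKy hyN hvj (n + 1) (j - (n + 1) - 1) (by omega) fun l hl _ => by omega,
            show j - (n + 1) - 1 + 1 = j - (n + 1) by omega]
      exact ⟨j - (n + 1), j - (n + 1), by omega, by omega, by omega,
        read_eq_sum_window hR hKy hyN hvj n _ (by omega) fun l hl _ => by omega, hrow1, fun l hl => by omega,
        fun L' hL' => hpart (j - (n + 1)) (by omega) (by omega) L' hL'⟩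
    · -- full: L = y − 1, row n+1 full as well
      have hrow1 : R v (n + 1) = ∑ l ∈ range y, K (n + 1) l * v (n + 2 + l) := by
        rw [read_eq_sum_window hR hKy hyN hvj (n + 1) (y - 1) (by omega) fun l hl hly => by omega, show y - 1 + 1 = y by omega]
      refine ⟨y - 1, y, by omega, by omega, by omega,
        read_eq_sum_window hR hKy hyN hvj n _ (by omega) fun l hl hly => by omega, hrow1, fun l hl => by omega, fun L' hL' => ?_⟩
      rw [show y - 1 + 1 = y by omega]; exact hfull hjy L' (by omega)
  -- growth inside row n+1's reach
  have hup : c * R v (n + 1) ≤ ∑ l ∈ range (L + 1), (if l < Lp then c * (H (n + 1 + l) * K (n + 1) l) else 0) * v (n + 1 + l) := by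
    rw [hrowN1, mul_sum, ← sum_range_add_sum_Ico _ (by omega : Lp ≤ L + 1)]
    rw [sum_eq_zero (s := Ico Lp (L + 1)) fun l hl => by rw [if_neg (by have := (mem_Ico.mp hl).1; omega), zero_mul], add_zero]
    refine sum_le_sum fun l hl => ?_
    have hl' := mem_range.mp hl
    rw [if_pos hl']
    have hg := hgrow (n + 1 + l) (by have := hreach l hl'; omega)
    rw [show n + 1 + l + 1 = n + 2 + l by ring] at hg
    calc c * (K (n + 1) l * v (n + 2 + l)) ≤ c * (K (n + 1) l * (H (n + 1 + l) * v (n + 1 + l))) :=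
          mul_le_mul_of_nonneg_left (mul_le_mul_of_nonneg_left hg (hK _ _)) hc
      _ = c * (H (n + 1 + l) * K (n + 1) l) * v (n + 1 + l) := by ring
  rw [hrowN]
  refine le_trans hup ?_
  rw [← sub_nonneg, ← sum_sub_distrib]
  have e : ∀ l ∈ range (L + 1), K n l * v (n + 1 + l) - (if l < Lp then c * (H (n + 1 + l) * K (n + 1) l) else 0) * v (n + 1 + l) =
      (K n l - if l < Lp then c * (H (n + 1 + l) * K (n + 1) l) else 0) * v (n + 1 + l) := fun l _ => by ring
  rw [sum_congr rfl e]
  refine abel_nonneg_mono (L + 1) _ (fun l => v (n + 1 + l)) (fun L' hL' => ?_) (fun l _ => hv0 _)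
    (fun l hl => by rw [show n + 1 + (l + 1) = n + 1 + l + 1 by ring]; exact hmono _ (by omega))
  -- the tail sum = Σ_{Ico L' (L+1)} K n l − c Σ_{Ico L' Lp} H K(n+1) l ≥ 0
  rw [sum_sub_distrib, sub_nonneg]
  have hsplit : ∑ l ∈ Ico L' (L + 1), (if l < Lp then c * (H (n + 1 + l) * K (n + 1) l) else 0) = c * ∑ l ∈ Ico L' Lp, H (n + 1 + l) * K (n + 1) l := by
    rcases Nat.lt_or_ge L' Lp with h1 | h1
    · rw [← sum_Ico_consecutive _ (by omega : L' ≤ Lp) hLp,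
        sum_eq_zero (s := Ico Lp (L + 1)) fun l hl => by rw [if_neg (by have := (mem_Ico.mp hl).1; omega)], add_zero, mul_sum]
      exact sum_congr rfl fun l hl => by rw [if_pos (mem_Ico.mp hl).2]
    · rw [Ico_eq_empty_of_le h1, sum_empty, mul_zero]
      exact sum_eq_zero fun l hl => by rw [if_neg (by have := (mem_Ico.mp hl).1; omega)]
  rw [hsplit]
  exact hstat L' (by omega)

/-- **THE READ-DECAY INEQUALITY FROM STATIC TAIL SUMS** (`c = 1 + M_n`): in the setting of `scaled_read_le_of_tail_sums`,
`M n·R v (n+1) ≤ R v n − R v (n+1)` — the hypothesis `hcrit`∕`hdecay` of (E81a)∕(E81c)∕(E81d) with `A = U = R v`. [folklore] -/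
theorem read_decay_of_tail_sums (hR : ∀ v n, R v n = ∑ l ∈ range N, K n l * v (n + 1 + l)) (hK : ∀ n l, 0 ≤ K n l)
    (hKy : ∀ n l, y ≤ l → K n l = 0) (hy : 1 ≤ y) (hyN : y ≤ N)
    {v : ℕ → ℝ} {j : ℕ} (hv0 : ∀ m, 0 ≤ v m) (hvj : ∀ m, j < m → v m = 0) (hmono : ∀ m, m < j → v m ≤ v (m + 1))
    {H : ℕ → ℝ} (hgrow : ∀ m, m < j → v (m + 1) ≤ H m * v m) {M : ℕ → ℝ} {n : ℕ} (hM : 0 ≤ M n)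
    (hfull : n + 1 + y ≤ j → ∀ L', L' < y → (1 + M n) * ∑ l ∈ Ico L' y, H (n + 1 + l) * K (n + 1) l ≤ ∑ l ∈ Ico L' y, K n l)
    (hpart : ∀ L, n + 1 + L = j → L < y → ∀ L', L' ≤ L →
      (1 + M n) * ∑ l ∈ Ico L' L, H (n + 1 + l) * K (n + 1) l ≤ ∑ l ∈ Ico L' (L + 1), K n l) :
    M n * R v (n + 1) ≤ R v n - R v (n + 1) := by
  have := scaled_read_le_of_tail_sums hR hK hKy hy hyN hv0 hvj hmono hgrow (by linarith : 0 ≤ 1 + M n) hfull hpart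
  linarith

/-- **READS NON-INCREASING FROM STATIC TAIL SUMS** (`c = 1`): `R v (n+1) ≤ R v n` — for the aggregate kernel this says that the DROPS of a surplus that
is non-decreasing below its edge are non-increasing in the pin, i.e. (with a flat input) the surplus one age down is again non-decreasing below the
edge: the (M1) property propagates. [folklore] -/
theorem read_antitone_of_tail_sums (hR : ∀ v n, R v n = ∑ l ∈ range N, K n l * v (n + 1 + l)) (hK : ∀ n l, 0 ≤ K n l)
    (hKy : ∀ n l, y ≤ l → K n l = 0) (hy : 1 ≤ y) (hyN : y ≤ N)
    {v : ℕ → ℝ} {j : ℕ} (hv0 : ∀ m, 0 ≤ v m) (hvj : ∀ m, j < m → v m = 0) (hmono : ∀ m, m < j → v m ≤ v (m + 1))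
    {H : ℕ → ℝ} (hgrow : ∀ m, m < j → v (m + 1) ≤ H m * v m) {n : ℕ}
    (hfull : n + 1 + y ≤ j → ∀ L', L' < y → ∑ l ∈ Ico L' y, H (n + 1 + l) * K (n + 1) l ≤ ∑ l ∈ Ico L' y, K n l)
    (hpart : ∀ L, n + 1 + L = j → L < y → ∀ L', L' ≤ L → ∑ l ∈ Ico L' L, H (n + 1 + l) * K (n + 1) l ≤ ∑ l ∈ Ico L' (L + 1), K n l) :
    R v (n + 1) ≤ R v n := by
  have := scaled_read_le_of_tail_sums hR hK hKy hy hyN hv0 hvj hmono hgrow zero_le_one (c := 1)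
    (fun h L' hL' => by rw [one_mul]; exact hfull h L' hL') (fun L hL hLy L' hL' => by rw [one_mul]; exact hpart L hL hLy L' hL')
  linarith

end Reads

end Summit.QuantumFields.BalabanUV.Beta.EriceRemainderEnclosureHistoryAutonomyComparisonAgeCompositionTailSums

end
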